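import Mathlib
import Summits.ValiantsHypothesis.ValiantsHypothesis.Theorems.LacunarySymmetroidMatrixDescartesCensusWindowFourRowMultRight

/-!
# `MatrixDescartes` census — WINDOW-4 ROWS OF A SHARP FEWNOMIAL, LOG-LINEAR TABLE FORM (what a kernel kill file instantiates)

HONEST FRAMING.  Object-search cell `pub-symmetroid`, door-A target `DoorA26 := PosRootLawAt 2 6 19`
(stmt-ValiantsHypothesis-19979; OPEN, typed, never asserted).  Companion of `…CensusWindowFourRowMult` / `…RowMultRight` (engine-2 g30)
in the style of `circuit_row_logs_of_table` (`…CensusSharpRowsLog`): the exponent table is a list `E`, the window's three gaps and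
four absolute twist multipliers are supplied as hypotheses about `E`, the witness parameter is a ratio of naturals, and the conclusion
is a disjunction of LINEAR inequalities in `Real.log |c t|`, `Real.log M_t` and logarithms of small naturals — the «W4 split» of a kill
file's LP tree, each branch closed by `linarith` over the certified log table.

* `window_four_left_rows_log_of_table` (λ = ln/ld > 1): D1 ∨ D2 ∨ D3 (the first two bound the same linear form: «row A»; D3: «row B»).
* `window_four_right_rows_log_of_table` (μ = mn/md ≥ 1, t = tn/td > 0, μ(U₁+V) + t·S < S): D2′ ∨ D3′.

Nothing here bounds any census count; `DoorA26` OPEN; nothing on `MatrixDescartes` (stmt-ValiantsHypothesis-18050) or `VP ≠ VNP`.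

[folklore] Rolle with multiplicity (Euler twists) + the window-4 witness; no single source.
-/

-- `Summit.ValiantsHypothesis.ValiantsHypothesis.…` repeats a component by the D-0017 layout
-- (single-conjunct summit), which the `dupNamespace` linter flags; the name is mandated.
set_option linter.dupNamespace false

namespace Summit.ValiantsHypothesis.ValiantsHypothesis.Theorems.LacunarySymmetroidMatrixDescartes.Census

open Polynomial Finset
open scoped BigOperators Polynomial

/-- `log` of a product of two positive powers. [folklore] -/
theorem log_pow_mul_pow {x y : ℝ} (hx : 0 < x) (hy : 0 < y) (m k : ℕ) :
    Real.log (x ^ m * y ^ k) = m * Real.log x + k * Real.log y := by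
  rw [Real.log_mul (pow_pos hx m).ne' (pow_pos hy k).ne', Real.log_pow, Real.log_pow]

/-- **WINDOW-4 LEFT ROWS, LOG TABLE FORM.**  For a sharp `n`-nomial (`hZ`), positions `r<s<u<v<n` with gaps `U₁, V, W` read off the
exponent list `E`, absolute twist multipliers `Mr, Ms, Mu, Mv`, and `λ = ln/ld` with `0 < ld < ln`:
D1 `V·(log(V(U₁+V)) + ℓc) + W·(log(U₁+V) + ℓc) < W·(log ln − log ld + log U₁ + ℓb) + V·(log((V+W)S) + ℓe)`  ∨
D2 `V·(log(ln−ld) − log ld + log U₁ + ℓb) + (V+W)·(log(U₁+V) + ℓc) ≤ V·(log S + ℓe) + (V+W)·(log ln − log ld + log U₁ + ℓb)`  ∨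
D3 `V·(log U₁ + ℓa) + (U₁+V)·(log(U₁+V) + ℓc) ≤ V·(log V + ℓc) + (U₁+V)·(log ln − log ld + log U₁ + ℓb)`,
where `ℓa = log|c r| + log Mr`, `ℓb = log|c s| + log Ms`, `ℓc = log|c u| + log Mu`, `ℓe = log|c v| + log Mv`, `S = U₁+V+W`. [folklore] -/
theorem window_four_left_rows_log_of_table {n : ℕ} {e : ℕ → ℕ} {c : ℕ → ℝ} (he : ∀ i j, i < j → j < n → e i < e j)
    (hZ : n ≤ (∑ t ∈ range n, C (c t) * X ^ (e t) : ℝ[X]).roots.countP (fun x => 0 < x) + 1)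
    (E : List ℕ) (hE : ∀ t, t < n → e t = E.getD t 0)
    {r s u v : ℕ} (hrs : r < s) (hsu : s < u) (huv : u < v) (hvn : v < n) (U₁ V W : ℕ)
    (hU₁ : E.getD r 0 + U₁ = E.getD s 0) (hV : E.getD s 0 + V = E.getD u 0) (hW : E.getD u 0 + W = E.getD v 0)
    (Mr Ms Mu Mv : ℝ)
    (hMr : |∏ w ∈ (range n).filter (fun w => ¬(w = r ∨ w = s ∨ w = u ∨ w = v)), (((E.getD r 0 : ℕ) : ℝ) - (E.getD w 0 : ℕ))| = Mr)
    (hMs : |∏ w ∈ (range n).filter (fun w => ¬(w = r ∨ w = s ∨ w = u ∨ w = v)), (((E.getD s 0 : ℕ) : ℝ) - (E.getD w 0 : ℕ))| = Ms)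
    (hMu : |∏ w ∈ (range n).filter (fun w => ¬(w = r ∨ w = s ∨ w = u ∨ w = v)), (((E.getD u 0 : ℕ) : ℝ) - (E.getD w 0 : ℕ))| = Mu)
    (hMv : |∏ w ∈ (range n).filter (fun w => ¬(w = r ∨ w = s ∨ w = u ∨ w = v)), (((E.getD v 0 : ℕ) : ℝ) - (E.getD w 0 : ℕ))| = Mv)
    (ln ld : ℕ) (hld : 0 < ld) (hl : ld < ln) :
    (V : ℝ) * (Real.log ((V * (U₁ + V) : ℕ) : ℝ) + (Real.log |c u| + Real.log Mu))
        + (W : ℝ) * (Real.log ((U₁ + V : ℕ) : ℝ) + (Real.log |c u| + Real.log Mu))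
      < (W : ℝ) * (Real.log (ln : ℝ) - Real.log (ld : ℝ) + Real.log (U₁ : ℝ) + (Real.log |c s| + Real.log Ms))
        + (V : ℝ) * (Real.log (((V + W) * (U₁ + V + W) : ℕ) : ℝ) + (Real.log |c v| + Real.log Mv))
    ∨ (V : ℝ) * (Real.log ((ln - ld : ℕ) : ℝ) - Real.log (ld : ℝ) + Real.log (U₁ : ℝ) + (Real.log |c s| + Real.log Ms))
        + ((V : ℝ) + W) * (Real.log ((U₁ + V : ℕ) : ℝ) + (Real.log |c u| + Real.log Mu))
      ≤ (V : ℝ) * (Real.log ((U₁ + V + W : ℕ) : ℝ) + (Real.log |c v| + Real.log Mv))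
        + ((V : ℝ) + W) * (Real.log (ln : ℝ) - Real.log (ld : ℝ) + Real.log (U₁ : ℝ) + (Real.log |c s| + Real.log Ms))
    ∨ (V : ℝ) * (Real.log (U₁ : ℝ) + (Real.log |c r| + Real.log Mr))
        + ((U₁ : ℝ) + V) * (Real.log ((U₁ + V : ℕ) : ℝ) + (Real.log |c u| + Real.log Mu))
      ≤ (V : ℝ) * (Real.log (V : ℝ) + (Real.log |c u| + Real.log Mu))
        + ((U₁ : ℝ) + V) * (Real.log (ln : ℝ) - Real.log (ld : ℝ) + Real.log (U₁ : ℝ) + (Real.log |c s| + Real.log Ms)) := by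
  classical
  have hn : 2 ≤ n := by omega
  -- transport the table hypotheses to `e`
  have hprod : ∀ t, t < n → (∏ w ∈ (range n).filter (fun w => ¬(w = r ∨ w = s ∨ w = u ∨ w = v)), ((e t : ℝ) - e w))
      = ∏ w ∈ (range n).filter (fun w => ¬(w = r ∨ w = s ∨ w = u ∨ w = v)), (((E.getD t 0 : ℕ) : ℝ) - (E.getD w 0 : ℕ)) := by
    intro t ht
    refine Finset.prod_congr rfl fun w hw => ?_
    have hw' : w < n := mem_range.mp (mem_filter.mp hw).1
    rw [hE t ht, hE w hw']
  have hMr' : |∏ w ∈ (range n).filter (fun w => ¬(w = r ∨ w = s ∨ w = u ∨ w = v)), ((e r : ℝ) - e w)| = Mr := by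
    rw [hprod r (by omega)]; exact hMr
  have hMs' : |∏ w ∈ (range n).filter (fun w => ¬(w = r ∨ w = s ∨ w = u ∨ w = v)), ((e s : ℝ) - e w)| = Ms := by
    rw [hprod s (by omega)]; exact hMs
  have hMu' : |∏ w ∈ (range n).filter (fun w => ¬(w = r ∨ w = s ∨ w = u ∨ w = v)), ((e u : ℝ) - e w)| = Mu := by
    rw [hprod u (by omega)]; exact hMu
  have hMv' : |∏ w ∈ (range n).filter (fun w => ¬(w = r ∨ w = s ∨ w = u ∨ w = v)), ((e v : ℝ) - e w)| = Mv := by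
    rw [hprod v hvn]; exact hMv
  have hU₁' : e r + U₁ = e s := by rw [hE r (by omega), hE s (by omega)]; exact hU₁
  have hV' : e s + V = e u := by rw [hE s (by omega), hE u (by omega)]; exact hV
  have hW' : e u + W = e v := by rw [hE u (by omega), hE v hvn]; exact hW
  have hU₁0 : 0 < U₁ := by have := he r s hrs (by omega); omega
  have hV0 : 0 < V := by have := he s u hsu (by omega); omega
  have hW0 : 0 < W := by have := he u v huv hvn; omega
  -- positivity of everything under a logarithm
  obtain ⟨_, hsg1, hsg2, hsg3⟩ := window_four_countP_of_sharp he hZ hrs hsu huv hvn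
  have hA : 0 < |c r| * Mr := by
    rw [← hMr', ← abs_mul]; exact abs_pos.mpr (by intro h; rw [h, zero_mul] at hsg1; exact lt_irrefl 0 hsg1)
  have hB : 0 < |c s| * Ms := by
    rw [← hMs', ← abs_mul]; exact abs_pos.mpr (by intro h; rw [h, mul_zero] at hsg1; exact lt_irrefl 0 hsg1)
  have hCc : 0 < |c u| * Mu := by
    rw [← hMu', ← abs_mul]; exact abs_pos.mpr (by intro h; rw [h, mul_zero] at hsg2; exact lt_irrefl 0 hsg2)
  have hEv : 0 < |c v| * Mv := by
    rw [← hMv', ← abs_mul]; exact abs_pos.mpr (by intro h; rw [h, mul_zero] at hsg3; exact lt_irrefl 0 hsg3)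
  have hcr : 0 < |c r| := abs_pos.mpr (coeff_ne_zero_of_sharp he hn hZ (by omega))
  have hcs : 0 < |c s| := abs_pos.mpr (coeff_ne_zero_of_sharp he hn hZ (by omega))
  have hcu : 0 < |c u| := abs_pos.mpr (coeff_ne_zero_of_sharp he hn hZ (by omega))
  have hcv : 0 < |c v| := abs_pos.mpr (coeff_ne_zero_of_sharp he hn hZ hvn)
  have hMr0 : 0 < Mr := by
    rcases lt_trichotomy Mr 0 with h' | h' | h'
    · exact absurd hA (not_lt.mpr (mul_nonpos_of_nonneg_of_nonpos hcr.le h'.le))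
    · rw [h', mul_zero] at hA; exact absurd hA (lt_irrefl 0)
    · exact h'
  have hMs0 : 0 < Ms := by
    rcases lt_trichotomy Ms 0 with h' | h' | h'
    · exact absurd hB (not_lt.mpr (mul_nonpos_of_nonneg_of_nonpos hcs.le h'.le))
    · rw [h', mul_zero] at hB; exact absurd hB (lt_irrefl 0)
    · exact h'
  have hMu0 : 0 < Mu := by
    rcases lt_trichotomy Mu 0 with h' | h' | h'
    · exact absurd hCc (not_lt.mpr (mul_nonpos_of_nonneg_of_nonpos hcu.le h'.le))
    · rw [h', mul_zero] at hCc; exact absurd hCc (lt_irrefl 0)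
    · exact h'
  have hMv0 : 0 < Mv := by
    rcases lt_trichotomy Mv 0 with h' | h' | h'
    · exact absurd hEv (not_lt.mpr (mul_nonpos_of_nonneg_of_nonpos hcv.le h'.le))
    · rw [h', mul_zero] at hEv; exact absurd hEv (lt_irrefl 0)
    · exact h'
  -- the parameter
  have hld' : (0 : ℝ) < ld := by exact_mod_cast hld
  have hln' : (0 : ℝ) < ln := by exact_mod_cast (hld.trans hl)
  have hlam : 1 < (ln : ℝ) / ld := by rw [lt_div_iff₀ hld', one_mul]; exact_mod_cast hl
  have hlamlog : Real.log ((ln : ℝ) / ld) = Real.log (ln : ℝ) - Real.log (ld : ℝ) := Real.log_div hln'.ne' hld'.ne'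
  have hlam1 : (ln : ℝ) / ld - 1 = ((ln - ld : ℕ) : ℝ) / ld := by
    rw [Nat.cast_sub hl.le]; field_simp
  have hlnld : (0 : ℝ) < ((ln - ld : ℕ) : ℝ) := by exact_mod_cast Nat.sub_pos_of_lt hl
  have hlam1log : Real.log ((ln : ℝ) / ld - 1) = Real.log ((ln - ld : ℕ) : ℝ) - Real.log (ld : ℝ) := by
    rw [hlam1]; exact Real.log_div hlnld.ne' hld'.ne'
  have row := window_four_left_row_of_sharp he hZ hrs hsu huv hvn U₁ V W hU₁' hV' hW' Mr Ms Mu Mv hMr' hMs' hMu' hMv'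
    ((ln : ℝ) / ld) hlam
  have hU₁r : (0 : ℝ) < U₁ := by exact_mod_cast hU₁0
  have hVr : (0 : ℝ) < V := by exact_mod_cast hV0
  have hWr : (0 : ℝ) < W := by exact_mod_cast hW0
  -- named non-vanishing facts pin every `Real.log_mul` rewrite
  have nV : (V : ℝ) ≠ 0 := hVr.ne'
  have nU₁ : (U₁ : ℝ) ≠ 0 := hU₁r.ne'
  have nU₁V : (U₁ : ℝ) + V ≠ 0 := by positivity
  have nS : (U₁ : ℝ) + V + W ≠ 0 := by positivity
  have nVU₁V : (V : ℝ) * ((U₁ : ℝ) + V) ≠ 0 := by positivity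
  have nVWS : ((V : ℝ) + W) * ((U₁ : ℝ) + V + W) ≠ 0 := by positivity
  have nlam : (ln : ℝ) / ld ≠ 0 := by positivity
  have nlam1 : (ln : ℝ) / ld - 1 ≠ 0 := by rw [hlam1]; positivity
  have nA : |c r| * Mr ≠ 0 := hA.ne'
  have nB : |c s| * Ms ≠ 0 := hB.ne'
  have nCc : |c u| * Mu ≠ 0 := hCc.ne'
  have nEv : |c v| * Mv ≠ 0 := hEv.ne'
  have nU₁A : (U₁ : ℝ) * (|c r| * Mr) ≠ 0 := mul_ne_zero nU₁ nA
  have nU₁B : (U₁ : ℝ) * (|c s| * Ms) ≠ 0 := mul_ne_zero nU₁ nB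
  have nVCc : (V : ℝ) * (|c u| * Mu) ≠ 0 := mul_ne_zero nV nCc
  have ncr : |c r| ≠ 0 := hcr.ne'
  have ncs : |c s| ≠ 0 := hcs.ne'
  have ncu : |c u| ≠ 0 := hcu.ne'
  have ncv : |c v| ≠ 0 := hcv.ne'
  have nMr : Mr ≠ 0 := hMr0.ne'
  have nMs : Ms ≠ 0 := hMs0.ne'
  have nMu : Mu ≠ 0 := hMu0.ne'
  have nMv : Mv ≠ 0 := hMv0.ne'
  rcases row with h1 | h2 | h3
  · left
    have hl := Real.log_lt_log (by positivity) h1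
    rw [log_pow_mul_pow (by positivity) (by positivity), log_pow_mul_pow (by positivity) (by positivity)] at hl
    rw [Real.log_mul nVU₁V nCc, Real.log_mul nU₁V nCc, Real.log_mul nlam nU₁B, Real.log_mul nU₁ nB,
      Real.log_mul nVWS nEv, Real.log_mul ncu nMu, Real.log_mul ncs nMs, Real.log_mul ncv nMv, hlamlog] at hl
    push_cast at hl ⊢
    linarith
  · right; left
    have hl := Real.log_le_log (by positivity) h2
    rw [log_pow_mul_pow (by positivity) (by positivity), log_pow_mul_pow (by positivity) (by positivity)] at hl
    rw [Real.log_mul nlam1 nU₁B, Real.log_mul nU₁V nCc, Real.log_mul nS nEv, Real.log_mul nlam nU₁B, Real.log_mul nU₁ nB,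
      Real.log_mul ncu nMu, Real.log_mul ncs nMs, Real.log_mul ncv nMv, hlamlog, hlam1log] at hl
    push_cast at hl ⊢
    linarith
  · right; right
    have hl := Real.log_le_log (by positivity) h3
    rw [log_pow_mul_pow (by positivity) (by positivity), log_pow_mul_pow (by positivity) (by positivity)] at hl
    rw [Real.log_mul nU₁ nA, Real.log_mul nU₁V nCc, Real.log_mul nV nCc, Real.log_mul nlam nU₁B, Real.log_mul nU₁ nB,
      Real.log_mul ncr nMr, Real.log_mul ncu nMu, Real.log_mul ncs nMs, hlamlog] at hl
    push_cast at hl ⊢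
    linarith

/-- **WINDOW-4 RIGHT ROWS, LOG TABLE FORM.**  As `window_four_left_rows_log_of_table` for the right witness family: `μ = mn/md ≥ 1`,
`t = tn/td > 0`, `μ(U₁+V) + t·S < S` (real-form hypothesis, `norm_num`-checkable on numerals):
D2′ `W·(log U₁ + ℓb) + V·(log((V+W)S) + ℓe) ≤ W·(log(U₁+V) + ℓc) + V·(log mn − log md + log(V(U₁+V)) + ℓc)`  ∨
D3′ `W·(log tn − log td + log V + ℓc) + (U₁+V)·(log mn − log md + log(V(U₁+V)) + ℓc) < W·(log U₁ + ℓa) + (U₁+V)·(log((V+W)S) + ℓe)`.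
[folklore] -/
theorem window_four_right_rows_log_of_table {n : ℕ} {e : ℕ → ℕ} {c : ℕ → ℝ} (he : ∀ i j, i < j → j < n → e i < e j)
    (hZ : n ≤ (∑ t ∈ range n, C (c t) * X ^ (e t) : ℝ[X]).roots.countP (fun x => 0 < x) + 1)
    (E : List ℕ) (hE : ∀ t, t < n → e t = E.getD t 0)
    {r s u v : ℕ} (hrs : r < s) (hsu : s < u) (huv : u < v) (hvn : v < n) (U₁ V W : ℕ)
    (hU₁ : E.getD r 0 + U₁ = E.getD s 0) (hV : E.getD s 0 + V = E.getD u 0) (hW : E.getD u 0 + W = E.getD v 0)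
    (Mr Ms Mu Mv : ℝ)
    (hMr : |∏ w ∈ (range n).filter (fun w => ¬(w = r ∨ w = s ∨ w = u ∨ w = v)), (((E.getD r 0 : ℕ) : ℝ) - (E.getD w 0 : ℕ))| = Mr)
    (hMs : |∏ w ∈ (range n).filter (fun w => ¬(w = r ∨ w = s ∨ w = u ∨ w = v)), (((E.getD s 0 : ℕ) : ℝ) - (E.getD w 0 : ℕ))| = Ms)
    (hMu : |∏ w ∈ (range n).filter (fun w => ¬(w = r ∨ w = s ∨ w = u ∨ w = v)), (((E.getD u 0 : ℕ) : ℝ) - (E.getD w 0 : ℕ))| = Mu)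
    (hMv : |∏ w ∈ (range n).filter (fun w => ¬(w = r ∨ w = s ∨ w = u ∨ w = v)), (((E.getD v 0 : ℕ) : ℝ) - (E.getD w 0 : ℕ))| = Mv)
    (mn md tn td : ℕ) (hmd : 0 < md) (hmn : md ≤ mn) (htn : 0 < tn) (htd : 0 < td)
    (hmut : (mn : ℝ) / md * ((U₁ : ℝ) + V) + (tn : ℝ) / td * ((U₁ : ℝ) + V + W) < (U₁ : ℝ) + V + W) :
    (W : ℝ) * (Real.log (U₁ : ℝ) + (Real.log |c s| + Real.log Ms))
        + (V : ℝ) * (Real.log (((V + W) * (U₁ + V + W) : ℕ) : ℝ) + (Real.log |c v| + Real.log Mv))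
      ≤ (W : ℝ) * (Real.log ((U₁ + V : ℕ) : ℝ) + (Real.log |c u| + Real.log Mu))
        + (V : ℝ) * (Real.log (mn : ℝ) - Real.log (md : ℝ) + Real.log ((V * (U₁ + V) : ℕ) : ℝ) + (Real.log |c u| + Real.log Mu))
    ∨ (W : ℝ) * (Real.log (tn : ℝ) - Real.log (td : ℝ) + Real.log (V : ℝ) + (Real.log |c u| + Real.log Mu))
        + ((U₁ : ℝ) + V) * (Real.log (mn : ℝ) - Real.log (md : ℝ) + Real.log ((V * (U₁ + V) : ℕ) : ℝ) + (Real.log |c u| + Real.log Mu))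
      < (W : ℝ) * (Real.log (U₁ : ℝ) + (Real.log |c r| + Real.log Mr))
        + ((U₁ : ℝ) + V) * (Real.log (((V + W) * (U₁ + V + W) : ℕ) : ℝ) + (Real.log |c v| + Real.log Mv)) := by
  classical
  have hn : 2 ≤ n := by omega
  have hprod : ∀ t, t < n → (∏ w ∈ (range n).filter (fun w => ¬(w = r ∨ w = s ∨ w = u ∨ w = v)), ((e t : ℝ) - e w))
      = ∏ w ∈ (range n).filter (fun w => ¬(w = r ∨ w = s ∨ w = u ∨ w = v)), (((E.getD t 0 : ℕ) : ℝ) - (E.getD w 0 : ℕ)) := by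
    intro t ht
    refine Finset.prod_congr rfl fun w hw => ?_
    have hw' : w < n := mem_range.mp (mem_filter.mp hw).1
    rw [hE t ht, hE w hw']
  have hMr' : |∏ w ∈ (range n).filter (fun w => ¬(w = r ∨ w = s ∨ w = u ∨ w = v)), ((e r : ℝ) - e w)| = Mr := by
    rw [hprod r (by omega)]; exact hMr
  have hMs' : |∏ w ∈ (range n).filter (fun w => ¬(w = r ∨ w = s ∨ w = u ∨ w = v)), ((e s : ℝ) - e w)| = Ms := by
    rw [hprod s (by omega)]; exact hMs
  have hMu' : |∏ w ∈ (range n).filter (fun w => ¬(w = r ∨ w = s ∨ w = u ∨ w = v)), ((e u : ℝ) - e w)| = Mu := by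
    rw [hprod u (by omega)]; exact hMu
  have hMv' : |∏ w ∈ (range n).filter (fun w => ¬(w = r ∨ w = s ∨ w = u ∨ w = v)), ((e v : ℝ) - e w)| = Mv := by
    rw [hprod v hvn]; exact hMv
  have hU₁' : e r + U₁ = e s := by rw [hE r (by omega), hE s (by omega)]; exact hU₁
  have hV' : e s + V = e u := by rw [hE s (by omega), hE u (by omega)]; exact hV
  have hW' : e u + W = e v := by rw [hE u (by omega), hE v hvn]; exact hW
  have hU₁0 : 0 < U₁ := by have := he r s hrs (by omega); omega
  have hV0 : 0 < V := by have := he s u hsu (by omega); omega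
  have hW0 : 0 < W := by have := he u v huv hvn; omega
  obtain ⟨_, hsg1, hsg2, hsg3⟩ := window_four_countP_of_sharp he hZ hrs hsu huv hvn
  have hA : 0 < |c r| * Mr := by
    rw [← hMr', ← abs_mul]; exact abs_pos.mpr (by intro h; rw [h, zero_mul] at hsg1; exact lt_irrefl 0 hsg1)
  have hB : 0 < |c s| * Ms := by
    rw [← hMs', ← abs_mul]; exact abs_pos.mpr (by intro h; rw [h, mul_zero] at hsg1; exact lt_irrefl 0 hsg1)
  have hCc : 0 < |c u| * Mu := by
    rw [← hMu', ← abs_mul]; exact abs_pos.mpr (by intro h; rw [h, mul_zero] at hsg2; exact lt_irrefl 0 hsg2)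
  have hEv : 0 < |c v| * Mv := by
    rw [← hMv', ← abs_mul]; exact abs_pos.mpr (by intro h; rw [h, mul_zero] at hsg3; exact lt_irrefl 0 hsg3)
  have hcr : 0 < |c r| := abs_pos.mpr (coeff_ne_zero_of_sharp he hn hZ (by omega))
  have hcs : 0 < |c s| := abs_pos.mpr (coeff_ne_zero_of_sharp he hn hZ (by omega))
  have hcu : 0 < |c u| := abs_pos.mpr (coeff_ne_zero_of_sharp he hn hZ (by omega))
  have hcv : 0 < |c v| := abs_pos.mpr (coeff_ne_zero_of_sharp he hn hZ hvn)
  have hMr0 : 0 < Mr := by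
    rcases lt_trichotomy Mr 0 with h' | h' | h'
    · exact absurd hA (not_lt.mpr (mul_nonpos_of_nonneg_of_nonpos hcr.le h'.le))
    · rw [h', mul_zero] at hA; exact absurd hA (lt_irrefl 0)
    · exact h'
  have hMs0 : 0 < Ms := by
    rcases lt_trichotomy Ms 0 with h' | h' | h'
    · exact absurd hB (not_lt.mpr (mul_nonpos_of_nonneg_of_nonpos hcs.le h'.le))
    · rw [h', mul_zero] at hB; exact absurd hB (lt_irrefl 0)
    · exact h'
  have hMu0 : 0 < Mu := by
    rcases lt_trichotomy Mu 0 with h' | h' | h'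
    · exact absurd hCc (not_lt.mpr (mul_nonpos_of_nonneg_of_nonpos hcu.le h'.le))
    · rw [h', mul_zero] at hCc; exact absurd hCc (lt_irrefl 0)
    · exact h'
  have hMv0 : 0 < Mv := by
    rcases lt_trichotomy Mv 0 with h' | h' | h'
    · exact absurd hEv (not_lt.mpr (mul_nonpos_of_nonneg_of_nonpos hcv.le h'.le))
    · rw [h', mul_zero] at hEv; exact absurd hEv (lt_irrefl 0)
    · exact h'
  have hmd' : (0 : ℝ) < md := by exact_mod_cast hmd
  have hmn' : (0 : ℝ) < mn := by exact_mod_cast (hmd.trans_le hmn)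
  have htn' : (0 : ℝ) < tn := by exact_mod_cast htn
  have htd' : (0 : ℝ) < td := by exact_mod_cast htd
  have hmu : 1 ≤ (mn : ℝ) / md := by rw [le_div_iff₀ hmd', one_mul]; exact_mod_cast hmn
  have ht : 0 < (tn : ℝ) / td := by positivity
  have hmulog : Real.log ((mn : ℝ) / md) = Real.log (mn : ℝ) - Real.log (md : ℝ) := Real.log_div hmn'.ne' hmd'.ne'
  have htlog : Real.log ((tn : ℝ) / td) = Real.log (tn : ℝ) - Real.log (td : ℝ) := Real.log_div htn'.ne' htd'.ne'
  have row := window_four_right_row_of_sharp he hZ hrs hsu huv hvn U₁ V W hU₁' hV' hW' Mr Ms Mu Mv hMr' hMs' hMu' hMv'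
    ((mn : ℝ) / md) ((tn : ℝ) / td) hmu ht hmut
  have hU₁r : (0 : ℝ) < U₁ := by exact_mod_cast hU₁0
  have hVr : (0 : ℝ) < V := by exact_mod_cast hV0
  have hWr : (0 : ℝ) < W := by exact_mod_cast hW0
  have nV : (V : ℝ) ≠ 0 := hVr.ne'
  have nU₁ : (U₁ : ℝ) ≠ 0 := hU₁r.ne'
  have nU₁V : (U₁ : ℝ) + V ≠ 0 := by positivity
  have nVU₁V : (V : ℝ) * ((U₁ : ℝ) + V) ≠ 0 := by positivity
  have nVWS : ((V : ℝ) + W) * ((U₁ : ℝ) + V + W) ≠ 0 := by positivity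
  have nmu : (mn : ℝ) / md ≠ 0 := by positivity
  have nt : (tn : ℝ) / td ≠ 0 := by positivity
  have nA : |c r| * Mr ≠ 0 := hA.ne'
  have nB : |c s| * Ms ≠ 0 := hB.ne'
  have nCc : |c u| * Mu ≠ 0 := hCc.ne'
  have nEv : |c v| * Mv ≠ 0 := hEv.ne'
  have nVCc : (V : ℝ) * (|c u| * Mu) ≠ 0 := mul_ne_zero nV nCc
  have nVU₁VCc : (V : ℝ) * ((U₁ : ℝ) + V) * (|c u| * Mu) ≠ 0 := mul_ne_zero nVU₁V nCc
  have ncr : |c r| ≠ 0 := hcr.ne'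
  have ncs : |c s| ≠ 0 := hcs.ne'
  have ncu : |c u| ≠ 0 := hcu.ne'
  have ncv : |c v| ≠ 0 := hcv.ne'
  have nMr : Mr ≠ 0 := hMr0.ne'
  have nMs : Ms ≠ 0 := hMs0.ne'
  have nMu : Mu ≠ 0 := hMu0.ne'
  have nMv : Mv ≠ 0 := hMv0.ne'
  rcases row with h2 | h3
  · left
    have hl := Real.log_le_log (by positivity) h2
    rw [log_pow_mul_pow (by positivity) (by positivity), log_pow_mul_pow (by positivity) (by positivity)] at hl
    rw [Real.log_mul nU₁ nB, Real.log_mul nVWS nEv, Real.log_mul nU₁V nCc, Real.log_mul nmu nVU₁VCc, Real.log_mul nVU₁V nCc,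
      Real.log_mul ncs nMs, Real.log_mul ncv nMv, Real.log_mul ncu nMu, hmulog] at hl
    push_cast at hl ⊢
    linarith
  · right
    have hl := Real.log_lt_log (by positivity) h3
    rw [log_pow_mul_pow (by positivity) (by positivity), log_pow_mul_pow (by positivity) (by positivity)] at hl
    rw [Real.log_mul nt nVCc, Real.log_mul nV nCc, Real.log_mul nmu nVU₁VCc, Real.log_mul nVU₁V nCc, Real.log_mul nU₁ nA,
      Real.log_mul nVWS nEv, Real.log_mul ncu nMu, Real.log_mul ncr nMr, Real.log_mul ncv nMv, hmulog, htlog] at hl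
    push_cast at hl ⊢
    linarith

end Summit.ValiantsHypothesis.ValiantsHypothesis.Theorems.LacunarySymmetroidMatrixDescartes.Census
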